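import Literature.MathematicalPhysics.KineticTheory.SiteChainLangevinKernel
import Literature.MathematicalPhysics.KineticTheory.LangevinChainExpBound
import Mathlib.Probability.Kernel.MeasurableIntegral
import HarnessLib

/-!
# Exponentially weighted pairings of the Langevin kernels of site-inhomogeneous chains

Topic `Literature/MathematicalPhysics/KineticTheory`, grouping namespace `…KineticTheory.HeatConduction`.
For the transition kernels `P_t = SiteChain.langevinKernel N T_L T_R t` of a uniformly confining
site-dependent chain (`SiteChainLangevinKernel.lean`) we work under the **exponential moment bound**

  (EM) `∫ e^{ϑH} dP_t(x, ·) ≤ K e^{rt} e^{ϑH(x)}`   (as a Lebesgue integral, all `t ≥ 0`, `x`),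

the form of Cuneo–Eckmann–Hairer–Rey-Bellet 2018 eq. (3.4) (`K = 1`, `r = ϑ ∑_b γ_b T_b`) and of the
time-uniform moment bound of a `V`-uniformly ergodic semigroup (`r = 0`). Consequences:

* `measurable_integral_langevinKernel(_uncurry)` — measurability of forecasts `(t, x) ↦ P_t φ(x)`;
* `integrable_exp_langevinKernel`, `integral_exp_langevinKernel_le`, `integrable_langevinKernel_of_abs_le`,
  `abs_integral_langevinKernel_mul_le`, `abs_integral_langevinKernel_le` — `|P_t(gφ)(x)| ≤ C K e^{rt} e^{ϑH(x)}`
  for `|φ| ≤ C e^{ϑH}`, `|g| ≤ 1`; `tendsto_integral_cutoff_langevinKernel` — `P_t(χ(H/(n+1)) φ) → P_t φ`;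
* `integrable_expWeight_mul_forecast`, `integrable_forecast_mul_oddMoment` — the Gibbs-type pairings
  `∫ e^{θH} P_s φ dx`, `∫ P_s φ · e^{θH}(p_0² - p_{N-1}²) dx` converge absolutely when
  `e^{(θ+ϑ)H}`, `(1 + p_0² + p_{N-1}²) e^{(θ+ϑ)H}` are Lebesgue integrable;
* `lintegral_ofReal_le_of_forall_integral_min_le` and `exp_moment_bound_of_mixing` — (EM) with
  `r = 0`, `K = 2C`, together with `e^{ϑH} ∈ L¹(ν)`, FOLLOW from a `V`-uniform mixing estimate
  `|P_t f(z) - ν(f)| ≤ C e^{ϑH(z)} e^{-ct}` (continuous `|f| ≤ e^{ϑH}`) for an invariant probability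
  measure `ν` with `ν(e^{ϑH}) ≤ C` (truncate `e^{ϑH}`, use `P_0 = id`, monotone limits).

## References

* N. Cuneo, J.-P. Eckmann, M. Hairer, L. Rey-Bellet, Electron. J. Probab. **23** (2018) no. 55, §3
  eq. (3.4), Thm 2.13 eq. (2.5).
* M. Hairer, J. C. Mattingly, *Yet another look at Harris' ergodic theorem for Markov chains* (2011),
  Thm 1.2.

## Design choices

* (EM) is a HYPOTHESIS (spelled out, no definition), so that both the a-priori bound (3.4) and a
  mixing hypothesis can feed the response theory (`SiteChainResponse*.lean`).
-/

noncomputable section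

open MeasureTheory ProbabilityTheory Filter Topology Set
open scoped NNReal ENNReal ContDiff

namespace Literature.MathematicalPhysics.KineticTheory.HeatConduction

open Literature.Probability.Process Literature.MathematicalPhysics.KineticTheory

variable {N : ℕ}

/-! ### A monotone-limit lemma -/

/-- If all truncations `min(e, n)` of a measurable `e ≥ 0` have `ρ`-integral at most `B` (finite
`ρ`), then `∫⁻ e dρ ≤ B`. [folklore] -/
theorem lintegral_ofReal_le_of_forall_integral_min_le {X : Type*} [MeasurableSpace X] {ρ : Measure X}
    [IsFiniteMeasure ρ] {e : X → ℝ} (he : Measurable e) (he0 : ∀ y, 0 ≤ e y) {B : ℝ}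
    (hB : ∀ n : ℕ, ∫ y, min (e y) n ∂ρ ≤ B) :
    ∫⁻ y, ENNReal.ofReal (e y) ∂ρ ≤ ENNReal.ofReal B := by
  have hfm : ∀ n : ℕ, Measurable fun y => ENNReal.ofReal (min (e y) n) := fun n =>
    ENNReal.measurable_ofReal.comp (he.min measurable_const)
  have hpt : ∀ y, liminf (fun n : ℕ => ENNReal.ofReal (min (e y) n)) atTop = ENNReal.ofReal (e y) := by
    intro y
    refine Tendsto.liminf_eq (tendsto_const_nhds.congr' ?_)
    obtain ⟨n₀, hn₀⟩ := exists_nat_ge (e y)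
    filter_upwards [eventually_ge_atTop n₀] with n hn
    rw [min_eq_left (hn₀.trans (by exact_mod_cast hn))]
  have hint : ∀ n : ℕ, Integrable (fun y => min (e y) n) ρ := fun n =>
    (integrable_const (n : ℝ)).mono' (he.min measurable_const).aestronglyMeasurable
      (Eventually.of_forall fun y => by
        rw [Real.norm_eq_abs, abs_of_nonneg (le_min (he0 y) n.cast_nonneg)]
        exact min_le_right _ _)
  calc ∫⁻ y, ENNReal.ofReal (e y) ∂ρ = ∫⁻ y, liminf (fun n : ℕ => ENNReal.ofReal (min (e y) n)) atTop ∂ρ :=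
        lintegral_congr fun y => (hpt y).symm
    _ ≤ liminf (fun n : ℕ => ∫⁻ y, ENNReal.ofReal (min (e y) n) ∂ρ) atTop := lintegral_liminf_le hfm
    _ ≤ ENNReal.ofReal B := by
        refine liminf_le_of_frequently_le' (Frequently.of_forall fun n => ?_)
        rw [← ofReal_integral_eq_lintegral_ofReal (hint n)
          (Eventually.of_forall fun y => le_min (he0 y) n.cast_nonneg)]
        exact ENNReal.ofReal_le_ofReal (hB n)

namespace SiteChain

variable (P : SiteChain)

/-! ### Measurability of forecasts -/

/-- Measurability of the forecast `x ↦ P_t φ(x)` for a strongly measurable `φ`. [folklore] -/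
theorem measurable_integral_langevinKernel (N : ℕ) (T_L T_R : ℝ) {φ : PhaseSpace N → ℝ}
    (hφm : StronglyMeasurable φ) (t : ℝ≥0) :
    Measurable fun x : PhaseSpace N => ∫ y, φ y ∂(P.langevinKernel N T_L T_R t x) :=
  (hφm.integral_kernel (κ := P.langevinKernel N T_L T_R t)).measurable

namespace UniformlyConfining

variable {P} (hP : P.UniformlyConfining) (N : ℕ) (T_L T_R : ℝ)
include hP

/-- Joint measurability of the forecast `(t, x) ↦ P_t φ(x)` for a strongly measurable `φ`. [folklore] -/
theorem measurable_integral_langevinKernel_uncurry {φ : PhaseSpace N → ℝ} (hφm : StronglyMeasurable φ) :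
    Measurable fun p : ℝ≥0 × PhaseSpace N => ∫ y, φ y ∂(P.langevinKernel N T_L T_R p.1 p.2) := by
  let κ : Kernel (ℝ≥0 × PhaseSpace N) (PhaseSpace N) :=
    ⟨fun p => P.langevinKernel N T_L T_R p.1 p.2, hP.measurable_langevinKernel N T_L T_R⟩
  exact (hφm.integral_kernel (κ := κ)).measurable

/-! ### Consequences of the exponential moment bound (EM) -/

section EM

variable {N T_L T_R} {ϑ K r : ℝ}
  (hK : ∀ (t : ℝ≥0) (x : PhaseSpace N),
    ∫⁻ y, ENNReal.ofReal (Real.exp (ϑ * P.hamiltonian N y)) ∂(P.langevinKernel N T_L T_R t x) ≤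
      ENNReal.ofReal (K * Real.exp (r * t) * Real.exp (ϑ * P.hamiltonian N x)))
include hK

/-- Under (EM), `e^{ϑH}` is integrable for every transition probability `P_t(x, ·)`. [folklore] -/
theorem integrable_exp_langevinKernel (t : ℝ≥0) (x : PhaseSpace N) :
    Integrable (fun y => Real.exp (ϑ * P.hamiltonian N y)) (P.langevinKernel N T_L T_R t x) := by
  have hc : Continuous fun y => Real.exp (ϑ * P.hamiltonian N y) :=
    Real.continuous_exp.comp (continuous_const.mul (hP.contDiff_hamiltonian N).continuous)
  refine ⟨hc.aestronglyMeasurable, ?_⟩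
  refine lt_of_le_of_lt ?_ (lt_of_le_of_lt (hK t x) ENNReal.ofReal_lt_top)
  refine lintegral_mono fun y => ?_
  rw [Real.enorm_eq_ofReal (Real.exp_pos _).le]

/-- (EM), Bochner form: `∫ e^{ϑH} dP_t(x,·) ≤ K e^{rt} e^{ϑH(x)}` (`K ≥ 0`). [cite: CuneoEckmannHairerReyBellet2018, §3 eq. (3.4)] -/
theorem integral_exp_langevinKernel_le (hK0 : 0 ≤ K) (t : ℝ≥0) (x : PhaseSpace N) :
    ∫ y, Real.exp (ϑ * P.hamiltonian N y) ∂(P.langevinKernel N T_L T_R t x) ≤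
      K * Real.exp (r * t) * Real.exp (ϑ * P.hamiltonian N x) := by
  rw [integral_eq_lintegral_of_nonneg_ae (Eventually.of_forall fun y => (Real.exp_pos _).le)
    (hP.integrable_exp_langevinKernel hK t x).aestronglyMeasurable]
  have h := hK t x
  have hfin : ∫⁻ y, ENNReal.ofReal (Real.exp (ϑ * P.hamiltonian N y)) ∂(P.langevinKernel N T_L T_R t x) ≠ ⊤ :=
    ne_top_of_le_ne_top ENNReal.ofReal_ne_top h
  have := (ENNReal.toReal_le_toReal hfin ENNReal.ofReal_ne_top).2 h
  rwa [ENNReal.toReal_ofReal (by positivity)] at this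

variable {φ : PhaseSpace N → ℝ} (hφc : Continuous φ) {C : ℝ}
  (hφ : ∀ y, |φ y| ≤ C * Real.exp (ϑ * P.hamiltonian N y))
include hφc hφ

/-- An observable dominated by `C e^{ϑH}` is integrable for every `P_t(x, ·)`. [folklore] -/
theorem integrable_langevinKernel_of_abs_le (t : ℝ≥0) (x : PhaseSpace N) :
    Integrable φ (P.langevinKernel N T_L T_R t x) := by
  refine ((hP.integrable_exp_langevinKernel hK t x).const_mul C).mono' hφc.aestronglyMeasurable
    (Eventually.of_forall fun y => ?_)
  rw [Real.norm_eq_abs]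
  exact hφ y

omit hφc in
/-- **The weighted bound of the forecast**: for any `g` with `|g| ≤ 1`,
`|∫ g φ dP_t(x,·)| ≤ C K e^{rt} e^{ϑH(x)}` (`K ≥ 0`). [folklore] -/
theorem abs_integral_langevinKernel_mul_le (hK0 : 0 ≤ K) (t : ℝ≥0) (x : PhaseSpace N)
    {g : PhaseSpace N → ℝ} (hg : ∀ y, |g y| ≤ 1) :
    |∫ y, g y * φ y ∂(P.langevinKernel N T_L T_R t x)| ≤
      C * (K * Real.exp (r * t) * Real.exp (ϑ * P.hamiltonian N x)) := by
  have hC : 0 ≤ C := by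
    have := (abs_nonneg _).trans (hφ x)
    exact nonneg_of_mul_nonneg_left this (Real.exp_pos _)
  have hI := hP.integrable_exp_langevinKernel hK t x
  calc |∫ y, g y * φ y ∂(P.langevinKernel N T_L T_R t x)|
      ≤ ∫ y, |g y * φ y| ∂(P.langevinKernel N T_L T_R t x) := abs_integral_le_integral_abs
    _ ≤ ∫ y, C * Real.exp (ϑ * P.hamiltonian N y) ∂(P.langevinKernel N T_L T_R t x) := by
        refine integral_mono_of_nonneg (Eventually.of_forall fun y => abs_nonneg _) (hI.const_mul C)
          (Eventually.of_forall fun y => ?_)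
        show |g y * φ y| ≤ C * Real.exp (ϑ * P.hamiltonian N y)
        rw [abs_mul]
        calc |g y| * |φ y| ≤ 1 * |φ y| := mul_le_mul_of_nonneg_right (hg y) (abs_nonneg _)
          _ = |φ y| := one_mul _
          _ ≤ _ := hφ y
    _ = C * ∫ y, Real.exp (ϑ * P.hamiltonian N y) ∂(P.langevinKernel N T_L T_R t x) := integral_const_mul _ _
    _ ≤ _ := mul_le_mul_of_nonneg_left (hP.integral_exp_langevinKernel_le hK hK0 t x) hC

omit hφc in
/-- `|P_t φ(x)| ≤ C K e^{rt} e^{ϑH(x)}`. [folklore] -/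
theorem abs_integral_langevinKernel_le (hK0 : 0 ≤ K) (t : ℝ≥0) (x : PhaseSpace N) :
    |∫ y, φ y ∂(P.langevinKernel N T_L T_R t x)| ≤
      C * (K * Real.exp (r * t) * Real.exp (ϑ * P.hamiltonian N x)) := by
  have h := hP.abs_integral_langevinKernel_mul_le hK hφ hK0 t x (g := fun _ => 1) (fun _ => by simp)
  simpa using h

/-- **Removing an energy truncation inside the forecast**: `P_t(χ(H/(n+1)) φ)(x) → P_t φ(x)` as
`n → ∞` (dominated convergence, majorant `|φ|`). [folklore] -/
theorem tendsto_integral_cutoff_langevinKernel (t : ℝ≥0) (x : PhaseSpace N) :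
    Tendsto (fun n : ℕ => ∫ y, smoothCutoff (P.hamiltonian N y / (n + 1)) * φ y
        ∂(P.langevinKernel N T_L T_R t x))
      atTop (𝓝 (∫ y, φ y ∂(P.langevinKernel N T_L T_R t x))) := by
  have hHc : Continuous (P.hamiltonian N) := (hP.contDiff_hamiltonian N).continuous
  have hsc : Continuous smoothCutoff := (contDiff_smoothCutoff (n := 0)).continuous
  have hI := hP.integrable_langevinKernel_of_abs_le hK hφc hφ t x
  refine tendsto_integral_of_dominated_convergence (fun y => |φ y|) (fun n => ?_) hI.abs
    (fun n => Eventually.of_forall fun y => ?_) (Eventually.of_forall fun y => ?_)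
  · exact ((hsc.comp (hHc.div_const _)).mul hφc).aestronglyMeasurable
  · rw [Real.norm_eq_abs, abs_mul]
    calc |smoothCutoff (P.hamiltonian N y / (n + 1))| * |φ y| ≤ 1 * |φ y| := by
          refine mul_le_mul_of_nonneg_right ?_ (abs_nonneg _)
          rw [abs_of_nonneg (smoothCutoff_nonneg _)]
          exact smoothCutoff_le_one _
      _ = |φ y| := one_mul _
  · refine tendsto_const_nhds.congr' ?_
    obtain ⟨n₀, hn₀⟩ := exists_nat_ge (P.hamiltonian N y)
    filter_upwards [eventually_ge_atTop n₀] with n hn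
    rw [smoothCutoff_of_le_one, one_mul]
    rw [div_le_one (by positivity)]
    calc P.hamiltonian N y ≤ n₀ := hn₀
      _ ≤ n := by exact_mod_cast hn
      _ ≤ n + 1 := by linarith

variable (hφ2 : ContDiff ℝ 2 φ) (hK0 : 0 ≤ K) (hr : 0 ≤ r)
include hK0

omit hφc in
/-- **The exponentially weighted forecast `x ↦ e^{θH(x)} P_s φ(x)` is Lebesgue integrable** whenever
`e^{(θ+ϑ)H}` is. [folklore] -/
theorem integrable_expWeight_mul_forecast (hφm : StronglyMeasurable φ) {θ : ℝ}
    (hθ : Integrable fun x : PhaseSpace N => Real.exp ((θ + ϑ) * P.hamiltonian N x)) (s : ℝ≥0) :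
    Integrable fun x : PhaseSpace N =>
      Real.exp (θ * P.hamiltonian N x) * ∫ y, φ y ∂(P.langevinKernel N T_L T_R s x) := by
  have hHc : Continuous (P.hamiltonian N) := (hP.contDiff_hamiltonian N).continuous
  have hmeas : AEStronglyMeasurable (fun x : PhaseSpace N =>
      Real.exp (θ * P.hamiltonian N x) * ∫ y, φ y ∂(P.langevinKernel N T_L T_R s x)) volume :=
    ((Real.continuous_exp.comp (continuous_const.mul hHc)).measurable.mul
      (P.measurable_integral_langevinKernel N _ _ hφm s)).aestronglyMeasurable
  refine ((hθ.const_mul (C * (K * Real.exp (r * s)))).mono' hmeas (Eventually.of_forall fun x => ?_))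
  have hb := hP.abs_integral_langevinKernel_le hK hφ hK0 s x
  rw [Real.norm_eq_abs, abs_mul, abs_of_pos (Real.exp_pos _),
    show (θ + ϑ) * P.hamiltonian N x = θ * P.hamiltonian N x + ϑ * P.hamiltonian N x by ring, Real.exp_add]
  calc _ ≤ Real.exp (θ * P.hamiltonian N x) * (C * (K * Real.exp (r * s) * Real.exp (ϑ * P.hamiltonian N x))) :=
        mul_le_mul_of_nonneg_left hb (Real.exp_pos _).le
    _ = _ := by ring

omit hφc in
/-- **The forecast against the odd weighted moment `x ↦ P_s φ(x) · e^{θH(x)} (p_0² - p_{N-1}²)` is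
Lebesgue integrable** whenever `(1 + p_0² + p_{N-1}²) e^{(θ+ϑ)H}` is (`N ≥ 1`). [folklore] -/
theorem integrable_forecast_mul_oddMoment (hN : 0 < N) (hφm : StronglyMeasurable φ) {θ : ℝ}
    (hθ : Integrable fun x : PhaseSpace N =>
      (1 + x.2 ⟨0, hN⟩ ^ 2 + x.2 ⟨N - 1, by omega⟩ ^ 2) * Real.exp ((θ + ϑ) * P.hamiltonian N x))
    (s : ℝ≥0) :
    Integrable fun x : PhaseSpace N =>
      (∫ y, φ y ∂(P.langevinKernel N T_L T_R s x)) *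
        (Real.exp (θ * P.hamiltonian N x) * (x.2 ⟨0, hN⟩ ^ 2 - x.2 ⟨N - 1, by omega⟩ ^ 2)) := by
  have hHc : Continuous (P.hamiltonian N) := (hP.contDiff_hamiltonian N).continuous
  have hC : 0 ≤ C := by
    have := (abs_nonneg _).trans (hφ 0)
    exact nonneg_of_mul_nonneg_left this (Real.exp_pos _)
  have hw : Continuous fun x : PhaseSpace N =>
      Real.exp (θ * P.hamiltonian N x) * (x.2 ⟨0, hN⟩ ^ 2 - x.2 ⟨N - 1, by omega⟩ ^ 2) :=
    (Real.continuous_exp.comp (continuous_const.mul hHc)).mul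
      ((((continuous_apply _).comp continuous_snd).pow 2).sub (((continuous_apply _).comp continuous_snd).pow 2))
  have hmeas : AEStronglyMeasurable (fun x : PhaseSpace N =>
      (∫ y, φ y ∂(P.langevinKernel N T_L T_R s x)) *
        (Real.exp (θ * P.hamiltonian N x) * (x.2 ⟨0, hN⟩ ^ 2 - x.2 ⟨N - 1, by omega⟩ ^ 2))) volume :=
    ((P.measurable_integral_langevinKernel N _ _ hφm s).mul hw.measurable).aestronglyMeasurable
  refine ((hθ.const_mul (C * (K * Real.exp (r * s)))).mono' hmeas (Eventually.of_forall fun x => ?_))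
  have hb := hP.abs_integral_langevinKernel_le hK hφ hK0 s x
  have hp : |x.2 ⟨0, hN⟩ ^ 2 - x.2 ⟨N - 1, by omega⟩ ^ 2| ≤ 1 + x.2 ⟨0, hN⟩ ^ 2 + x.2 ⟨N - 1, by omega⟩ ^ 2 := by
    have h1 : 0 ≤ x.2 ⟨0, hN⟩ ^ 2 := sq_nonneg _
    have h2 : 0 ≤ x.2 ⟨N - 1, by omega⟩ ^ 2 := sq_nonneg _
    rw [abs_le]; constructor <;> linarith
  rw [Real.norm_eq_abs, abs_mul, abs_mul, abs_of_pos (Real.exp_pos _),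
    show (θ + ϑ) * P.hamiltonian N x = θ * P.hamiltonian N x + ϑ * P.hamiltonian N x by ring, Real.exp_add]
  have hE1 := (Real.exp_pos (θ * P.hamiltonian N x)).le
  calc |∫ y, φ y ∂(P.langevinKernel N T_L T_R s x)| *
        (Real.exp (θ * P.hamiltonian N x) * |x.2 ⟨0, hN⟩ ^ 2 - x.2 ⟨N - 1, by omega⟩ ^ 2|)
      ≤ (C * (K * Real.exp (r * s) * Real.exp (ϑ * P.hamiltonian N x))) *
        (Real.exp (θ * P.hamiltonian N x) * (1 + x.2 ⟨0, hN⟩ ^ 2 + x.2 ⟨N - 1, by omega⟩ ^ 2)) :=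
        mul_le_mul hb (mul_le_mul_of_nonneg_left hp hE1) (by positivity) (by positivity)
    _ = _ := by ring

end EM

/-! ### (EM) from a uniform mixing estimate -/

/-- **A `V`-uniform mixing estimate yields the exponential moment bound (EM).** If `ν` is a
probability measure with `ν(e^{ϑH}) ≤ C` and `|P_t f(z) - ν(f)| ≤ C e^{ϑH(z)} e^{-ct}` for all
continuous `f` with `|f| ≤ e^{ϑH}`, all `z` and `t ≥ 0`, then `e^{ϑH} ∈ L¹(ν)` and
`∫ e^{ϑH} dP_t(z,·) ≤ 2C e^{ϑH(z)}` for all `t, z` (Lebesgue-integral form). The truncations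
`min(e^{ϑH}, n)` are admissible `f`'s; at `t = 0` (`P_0 = id`) the estimate bounds `ν(min(e^{ϑH}, n))`
uniformly, so `e^{ϑH} ∈ L¹(ν)` by monotone limits, and then the estimate at time `t` bounds
`P_t(min(e^{ϑH}, n))(z) ≤ C + C e^{ϑH(z)}`. [cite: HairerMattingly2011, Thm 1.2] -/
theorem exp_moment_bound_of_mixing {ϑ C c : ℝ} (hϑ : 0 ≤ ϑ) (hc : 0 ≤ c) {ν : Measure (PhaseSpace N)}
    [IsProbabilityMeasure ν]
    (hνC : ∫ y, Real.exp (ϑ * P.hamiltonian N y) ∂ν ≤ C)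
    (hmix : ∀ (z : PhaseSpace N) (t : ℝ≥0) (f : PhaseSpace N → ℝ), Continuous f →
      (∀ y, |f y| ≤ Real.exp (ϑ * P.hamiltonian N y)) →
      |(∫ y, f y ∂(P.langevinKernel N T_L T_R t z)) - ∫ y, f y ∂ν| ≤
        C * Real.exp (ϑ * P.hamiltonian N z) * Real.exp (-c * t)) :
    Integrable (fun y => Real.exp (ϑ * P.hamiltonian N y)) ν ∧
      ∀ (t : ℝ≥0) (z : PhaseSpace N),
        ∫⁻ y, ENNReal.ofReal (Real.exp (ϑ * P.hamiltonian N y)) ∂(P.langevinKernel N T_L T_R t z) ≤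
          ENNReal.ofReal (2 * C * Real.exp (0 * t) * Real.exp (ϑ * P.hamiltonian N z)) := by
  haveI := fun t => hP.isMarkovKernel_langevinKernel N T_L T_R t
  set e : PhaseSpace N → ℝ := fun y => Real.exp (ϑ * P.hamiltonian N y) with he_def
  have hHc : Continuous (P.hamiltonian N) := (hP.contDiff_hamiltonian N).continuous
  have hec : Continuous e := Real.continuous_exp.comp (continuous_const.mul hHc)
  have he0 : ∀ y, 0 ≤ e y := fun y => (Real.exp_pos _).le
  have he1 : ∀ y, 1 ≤ e y := fun y => Real.one_le_exp (mul_nonneg hϑ (hP.hamiltonian_nonneg N y))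
  -- the truncations are admissible observables
  have hfc : ∀ n : ℕ, Continuous fun y => min (e y) n := fun n => hec.min continuous_const
  have hfb : ∀ (n : ℕ) (y : PhaseSpace N), |min (e y) n| ≤ Real.exp (ϑ * P.hamiltonian N y) := fun n y => by
    rw [abs_of_nonneg (le_min (he0 y) n.cast_nonneg)]
    exact min_le_left _ _
  -- `C ≥ 0` (from the estimate at `t = 0`, `f = 0`)
  have hC0 : 0 ≤ C := by
    have h := hmix 0 0 (fun _ => 0) continuous_const (fun y => by rw [abs_zero]; exact he0 y)
    simp only [integral_zero, sub_self, abs_zero, NNReal.coe_zero, mul_zero, Real.exp_zero, mul_one] at h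
    exact nonneg_of_mul_nonneg_left h (Real.exp_pos _)
  -- Step 1: `e ∈ L¹(ν)` from the estimate at `t = 0`
  have hν1 : ∀ n : ℕ, ∫ y, min (e y) n ∂ν ≤ (1 + C) * e 0 := by
    intro n
    have h := hmix 0 0 _ (hfc n) (hfb n)
    rw [hP.langevinKernel_zero N T_L T_R, Kernel.id_apply, integral_dirac] at h
    simp only [NNReal.coe_zero, mul_zero, Real.exp_zero, mul_one] at h
    have h2 : min (e 0) n ≤ e 0 := min_le_left _ _
    have h3 := (abs_sub_comm (min (e 0) (n : ℝ)) (∫ y, min (e y) n ∂ν)) ▸ h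
    have h4 := (abs_le.1 h3).2
    nlinarith [he0 0]
  have hνlin := lintegral_ofReal_le_of_forall_integral_min_le hec.measurable he0 hν1
  have hνint : Integrable e ν := by
    refine ⟨hec.aestronglyMeasurable, ?_⟩
    refine lt_of_le_of_lt ?_ (lt_of_le_of_lt hνlin ENNReal.ofReal_lt_top)
    exact lintegral_mono fun y => by rw [Real.enorm_eq_ofReal (he0 y)]
  refine ⟨hνint, fun t z => ?_⟩
  -- Step 2: the truncated forecasts are bounded by `C + C e(z)`
  have hν2 : ∀ n : ℕ, ∫ y, min (e y) n ∂ν ≤ C := fun n =>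
    (integral_mono ((integrable_const (n : ℝ)).mono' (hfc n).aestronglyMeasurable
      (Eventually.of_forall fun y => by rw [Real.norm_eq_abs, abs_of_nonneg (le_min (he0 y) n.cast_nonneg)];
                                          exact min_le_right _ _)) hνint fun y => min_le_left _ _).trans hνC
  have hPt : ∀ n : ℕ, ∫ y, min (e y) n ∂(P.langevinKernel N T_L T_R t z) ≤ 2 * C * Real.exp (0 * t) * e z := by
    intro n
    have h := hmix z t _ (hfc n) (hfb n)
    have h4 := (abs_le.1 h).2
    rw [zero_mul, Real.exp_zero, mul_one]
    have hle1 : Real.exp (-c * (t : ℝ)) ≤ 1 := Real.exp_le_one_iff.2 (by nlinarith [t.coe_nonneg])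
    nlinarith [hν2 n, he1 z, mul_le_mul_of_nonneg_left hle1 (mul_nonneg hC0 (he0 z)), mul_nonneg hC0 (he0 z)]
  exact (lintegral_ofReal_le_of_forall_integral_min_le hec.measurable he0 hPt)

end UniformlyConfining

end SiteChain

end Literature.MathematicalPhysics.KineticTheory.HeatConduction
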